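import Summits.ValiantsHypothesis.ValiantsHypothesis.Theorems.NewtonUnitEquationsTwoProductsExpBlockShallowQ
import Summits.ValiantsHypothesis.ValiantsHypothesis.Theorems.NewtonUnitEquationsTwoProductsExpBlockTensorVisible
import Summits.ValiantsHypothesis.ValiantsHypothesis.Theorems.NewtonUnitEquationsTwoProductsSubmergedWitness

/-!
# K10 `exp-block-tensorisation` — the SHALLOW BRIDGE `shallowVisible_holds : ShallowVisible` and the corollary `blockShallowQuasiPoly_holds`

Completes the natural (shallow) form of val-idea-37 g2's card: under `ShallowGraded` (only multisets with `≤ m` letters are controlled) every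
visible point of the log-sum is the point of a tuple of the CONFIGURATION SHADOW of the shallow configuration (`ShallowVisible`), hence
(`shallowQ_holds`, P1) every cell family has at most `(s+2)·((m+1)·8(2m+2)³)^⌈log₂ b⌉` points (`blockShallowQuasiPoly_holds : BlockShallowQuasiPoly`).
Proof of the bridge: (1) shallow tuples are the block tuples of graded multisets (`GradedAt` via `gradedAt_of_shallowGraded`), so the point map is
INJECTIVE on the shallow configuration; (2) SHALLOW L1: at a shallow tuple `a`, `logDiff (Σ a) = (−1)^{R+1}(R−1)! · φ(x_a)` where `x_a` is the
Khatri–Rao column `expCol a` and `φ(y) = Σ_{i<m} y_i − Σ_{i≥m} y_i` (the one-tail identity `logCoeff_eq_coeff_prod_truncExp` plus the fibre lemma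
`coeff_{Σa} Π_B P_B = Π_B coeff_{a_B} P_B`); (3) a tie-free perturbation `ξ'` of the valid witness keeps `l` strictly above every point of
`supp D` and is injective on the shallow points; (4) greedy certificate: every shallow tuple strictly `ξ'`-above `a_l` has its point outside
`supp D`, so `φ` kills its column; `φ(x_{a_l}) ≠ 0`; hence `x_{a_l}` is not in their span.
Helper mode (`--supports stmt-ValiantsHypothesis-5906 --as helper`).  HONEST LABEL: a proper positive sub-case (SHALLOW-graded alphabets, quasi-polynomial count);
nothing here closes 5906 or 5905 (`TwoProducts` / `ResidualLawV23` / `PlanarCellBound` / `DissociatedUniform` OPEN); VP ≠ VNP is NOT proved.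
No instances, no notation, no named facts. [folklore]
-/

noncomputable section
set_option linter.dupNamespace false

namespace Summit.ValiantsHypothesis.ValiantsHypothesis.Theorems.NewtonUnitEquations.TwoProducts.ExpBlock

open MvPolynomial Finset
open Summit.ValiantsHypothesis.ValiantsHypothesis.Theorems.NewtonUnitEquations.TwoProducts.FormalLogLinearisation
open Summit.ValiantsHypothesis.ValiantsHypothesis.Theorems.NewtonUnitEquations.TwoProducts.PlanarCell
open Summit.ValiantsHypothesis.ValiantsHypothesis.Theorems.NewtonUnitEquations.TwoProducts.Submerged (wt_add_smul exists_wt_injective exists_eps_of_finset)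
open Summit.ValiantsHypothesis.ValiantsHypothesis.Theorems.NewtonUnitEquationsDissociatedUniform

variable {m b : ℕ}

/-! ## Shallow tuples and graded multisets -/

/-- The point of a multiset is the sum of its block sums. [folklore] -/
theorem sum_eq_sum_filter_sum (blk : Expo → Fin b) (k : Multiset Expo) :
    k.sum = ∑ B, (k.filter (fun e => blk e = B)).sum := by
  classical
  induction k using Multiset.induction_on with
  | empty => simp
  | cons a k ih =>
    have h : ∀ B, ((a ::ₘ k).filter (fun e => blk e = B)).sum =
        (if blk a = B then a else 0) + (k.filter (fun e => blk e = B)).sum := by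
      intro B
      rw [Multiset.filter_cons]
      split_ifs <;> simp
    simp only [h, Finset.sum_add_distrib, Multiset.sum_cons, ← ih]
    rw [Finset.sum_ite_eq]
    simp

/-- A tuple of the shallow configuration is the block tuple of a multiset of `≤ m` letters of `A`. [folklore] -/
theorem exists_multiset_of_mem_shallowConfig (A : Finset Expo) (blk : Expo → Fin b) (m : ℕ) {a : Fin b → Expo}
    (ha : a ∈ shallowConfig A blk m) :
    ∃ k : Multiset Expo, (∀ e ∈ k, e ∈ A) ∧ Multiset.card k ≤ m ∧ (∀ B, (k.filter (fun e => blk e = B)).sum = a B) ∧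
      k.sum = ∑ B, a B := by
  classical
  unfold shallowConfig at ha
  obtain ⟨-, r, hr, hrB⟩ := Finset.mem_filter.1 ha
  have hg : ∀ B, ∃ g : Fin (r B) → Expo, (∀ i, g i ∈ A.filter (fun e => blk e = B)) ∧ ∑ i, g i = a B := fun B =>
    (mem_support_pow_sum_monomial_iff _ _ _).1 (hrB B)
  choose g hgA hgs using hg
  obtain ⟨k, hkA, hkcard, hkB, hksum⟩ := exists_multiset_of_blockFamily A blk (fun B => (r B : ℕ)) g hgA
  refine ⟨k, hkA, ?_, fun B => by rw [hkB, hgs], by rw [hksum]; exact Finset.sum_congr rfl fun B _ => hgs B⟩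
  rw [card_eq_sum_card_filter blk k]
  calc ∑ B, Multiset.card (k.filter (fun e => blk e = B)) = ∑ B, (r B : ℕ) := Finset.sum_congr rfl fun B _ => hkcard B
    _ ≤ m := hr

/-- A multiset as a tuple: `Fin (card) → letters` with the right sum. [folklore] -/
theorem exists_fin_of_multiset (s : Multiset Expo) :
    ∃ g : Fin (Multiset.card s) → Expo, (∀ i, g i ∈ s) ∧ ∑ i, g i = s.sum := by
  classical
  refine ⟨fun i => s.toList.get (Fin.cast (Multiset.length_toList s).symm i), fun i => ?_, ?_⟩
  · exact Multiset.mem_toList.1 (List.get_mem _ _)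
  · have h1 : ∑ i : Fin (Multiset.card s), s.toList.get (Fin.cast (Multiset.length_toList s).symm i) =
        ∑ i : Fin s.toList.length, s.toList.get i :=
      Fintype.sum_equiv (finCongr (Multiset.length_toList s).symm) _ _ fun i => rfl
    rw [h1, ← List.sum_ofFn, List.ofFn_get, Multiset.sum_toList]

/-- The block tuple of a multiset of `≤ m` letters of `A` lies in the shallow configuration. [folklore] -/
theorem blockTuple_mem_shallowConfig (A : Finset Expo) (blk : Expo → Fin b) (m : ℕ) (k : Multiset Expo)
    (hkA : ∀ e ∈ k, e ∈ A) (hkm : Multiset.card k ≤ m) :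
    (fun B => (k.filter (fun e => blk e = B)).sum) ∈ shallowConfig A blk m := by
  classical
  have hrB : ∀ B, Multiset.card (k.filter (fun e => blk e = B)) ≤ m := fun B =>
    (Multiset.card_le_card (Multiset.filter_le _ _)).trans hkm
  have hlevel : ∀ B, (k.filter (fun e => blk e = B)).sum ∈ blockFrameR A blk (Multiset.card (k.filter (fun e => blk e = B))) B := by
    intro B
    obtain ⟨g, hg, hgs⟩ := exists_fin_of_multiset (k.filter (fun e => blk e = B))
    refine (mem_support_pow_sum_monomial_iff _ _ _).2 ⟨g, fun i => ?_, hgs⟩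
    have hi := Multiset.mem_filter.1 (hg i)
    exact Finset.mem_filter.2 ⟨hkA _ hi.1, hi.2⟩
  unfold shallowConfig
  refine Finset.mem_filter.2 ⟨Fintype.mem_piFinset.2 fun B => ?_, fun B => ⟨Multiset.card (k.filter (fun e => blk e = B)),
    Nat.lt_succ_of_le (hrB B)⟩, ?_, fun B => hlevel B⟩
  · rw [blockFrame_eq_biUnion, Finset.mem_biUnion]
    exact ⟨_, Finset.mem_range.2 (Nat.lt_succ_of_le (hrB B)), hlevel B⟩
  · simp only
    rw [← card_eq_sum_card_filter blk k]
    exact hkm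

/-- **Point injectivity.**  Under `ShallowGraded` two shallow tuples with the same point coincide. [folklore] -/
theorem eq_of_sum_eq_of_shallowGraded {A : Finset Expo} {blk : Expo → Fin b} {m : ℕ} (hG : ShallowGraded A blk m)
    {a a' : Fin b → Expo} (ha : a ∈ shallowConfig A blk m) (ha' : a' ∈ shallowConfig A blk m) (h : ∑ B, a B = ∑ B, a' B) : a = a' := by
  obtain ⟨k, hkA, hkm, hkB, hks⟩ := exists_multiset_of_mem_shallowConfig A blk m ha
  obtain ⟨k', hk'A, -, hk'B, hk's⟩ := exists_multiset_of_mem_shallowConfig A blk m ha'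
  funext B
  rw [← hkB B, ← hk'B B]
  exact (hG k k' hkA hk'A hkm (by rw [hks, hk's, h]) B).1

/-! ## The shallow L1 -/

/-- Coefficients of a product as a sum over support tuples. [folklore] -/
theorem coeff_prod_eq_sum {b : ℕ} (P : Fin b → MvPolynomial (Fin 2) ℂ) (p : Expo) :
    coeff p (∏ B, P B) = ∑ d ∈ Fintype.piFinset (fun B => (P B).support),
      if ∑ B, d B = p then ∏ B, coeff (d B) (P B) else 0 := by
  classical
  have h : ∏ B, P B = ∑ d ∈ Fintype.piFinset (fun B => (P B).support), monomial (∑ B, d B) (∏ B, coeff (d B) (P B)) := by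
    conv_lhs => rw [show (∏ B, P B) = ∏ B, ∑ e ∈ (P B).support, monomial e (coeff e (P B)) from
      Finset.prod_congr rfl fun B _ => ((P B).as_sum)]
    rw [Finset.prod_univ_sum]
    refine Finset.sum_congr rfl fun d _ => ?_
    rw [monomial_sum_prod]
  rw [h, coeff_sum]
  refine Finset.sum_congr rfl fun d _ => ?_
  rw [coeff_monomial]

/-- **Fibre lemma.**  At the point of a GRADED multiset with block tuple `a`, the coefficient of `∏_B E_m(q_B)` is the product of the block
coefficients at `a_B`. [folklore] -/
theorem coeff_prod_truncExp_eq_prod {A : Finset Expo} {blk : Expo → Fin b} {m : ℕ} (q : MvPolynomial (Fin 2) ℂ) (hqA : q.support ⊆ A)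
    (k : Multiset Expo) (hG : GradedAt A blk k) (a : Fin b → Expo) (ha : ∀ B, (k.filter (fun e => blk e = B)).sum = a B) :
    coeff (∑ B, a B) (∏ B, truncExp m (restrictBlock blk B q)) = ∏ B, coeff (a B) (truncExp m (restrictBlock blk B q)) := by
  classical
  rw [coeff_prod_eq_sum]
  have hks : k.sum = ∑ B, a B := by rw [sum_eq_sum_filter_sum blk k]; exact Finset.sum_congr rfl fun B _ => ha B
  -- every tuple of the fibre is `a`
  have hfib : ∀ d ∈ (Fintype.piFinset fun B => (truncExp m (restrictBlock blk B q)).support), ∑ B, d B = ∑ B, a B → d = a := by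
    intro d hd1 hd2
    have hdF : ∀ B, d B ∈ blockFrame A blk m B := fun B =>
      support_truncExp_subset A blk m B _ (support_restrictBlock_subset blk B q A hqA) (Fintype.mem_piFinset.1 hd1 B)
    obtain ⟨k', hk'A, -, hk'B, hk's⟩ := exists_multiset_of_blockTuple A blk m d hdF
    funext B
    rw [← hk'B B, ← ha B]
    exact ((hG k' hk'A (by rw [hks, hk's, hd2]) B).1).symm
  rw [Finset.sum_eq_single a]
  · rw [if_pos rfl]
  · intro d hd hne
    rw [if_neg]
    exact fun h => hne (hfib d hd h)
  · intro hmem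
    rw [if_pos rfl]
    rw [Fintype.mem_piFinset] at hmem
    push Not at hmem
    obtain ⟨B, hB⟩ := hmem
    exact Finset.prod_eq_zero (Finset.mem_univ B) (notMem_support_iff.1 hB)

/-- The sign functional `φ(y) = Σ_{i<m} y_i − Σ_{i≥m} y_i` on `Fin (m+m) → ℂ`. [folklore] -/
def signFun (m : ℕ) : (Fin (m + m) → ℂ) →ₗ[ℂ] ℂ :=
  ∑ i : Fin (m + m), (Fin.append (fun _ : Fin m => (1 : ℂ)) (fun _ : Fin m => (-1 : ℂ)) i) • LinearMap.proj i

/-- The sign functional on a vector. [folklore] -/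
theorem signFun_apply (m : ℕ) (y : Fin (m + m) → ℂ) :
    signFun m y = ∑ j : Fin m, y (Fin.castAdd m j) - ∑ j : Fin m, y (Fin.natAdd m j) := by
  rw [signFun, LinearMap.sum_apply, Fin.sum_univ_add]
  simp only [LinearMap.smul_apply, LinearMap.proj_apply, smul_eq_mul, Fin.append_left, Fin.append_right, one_mul, neg_one_mul,
    Finset.sum_neg_distrib]
  ring

/-- **SHALLOW L1.**  At the block tuple `a` of a non-zero graded multiset `k` with block counts `≤ m`,
`logDiff u v (Σ a) = (−1)^{|k|+1} (|k|−1)! · φ(expCol a)`. [folklore] -/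
theorem logDiff_eq_signFun_expCol {A : Finset Expo} {blk : Expo → Fin b} {m : ℕ} (u v : Fin m → MvPolynomial (Fin 2) ℂ)
    (hu : ∀ j, coeff 0 (u j) = 0 ∧ (u j).support ⊆ A) (hv : ∀ j, coeff 0 (v j) = 0 ∧ (v j).support ⊆ A)
    (k : Multiset Expo) (hG : GradedAt A blk k) (hkA : ∀ e ∈ k, e ∈ A) (hk0 : k ≠ 0)
    (hkm : ∀ B, Multiset.card (k.filter (fun e => blk e = B)) ≤ m) (a : Fin b → Expo)
    (ha : ∀ B, (k.filter (fun e => blk e = B)).sum = a B) :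
    logDiff u v (∑ B, a B) = (-1 : ℂ) ^ (Multiset.card k + 1) * (Nat.factorial (Multiset.card k - 1) : ℂ) *
      signFun m (expCol blk u v a) := by
  classical
  have hks : k.sum = ∑ B, a B := by rw [sum_eq_sum_filter_sum blk k]; exact Finset.sum_congr rfl fun B _ => ha B
  rw [signFun_apply]
  have hcol : ∀ i, expCol blk u v a i = ∏ B, coeff (a B) (truncExp m (restrictBlock blk B (Fin.append u v i))) := fun i => rfl
  simp only [hcol, Fin.append_left, Fin.append_right]
  have hu' : ∀ j, logCoeff (u j) (∑ B, a B) = (-1 : ℂ) ^ (Multiset.card k + 1) * (Nat.factorial (Multiset.card k - 1) : ℂ) *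
      ∏ B, coeff (a B) (truncExp m (restrictBlock blk B (u j))) := fun j => by
    rw [← coeff_prod_truncExp_eq_prod (u j) (hu j).2 k hG a ha, ← hks]
    exact logCoeff_eq_coeff_prod_truncExp (u j) (hu j).2 k hG hkA (hu j).1 hk0 m hkm
  have hv' : ∀ j, logCoeff (v j) (∑ B, a B) = (-1 : ℂ) ^ (Multiset.card k + 1) * (Nat.factorial (Multiset.card k - 1) : ℂ) *
      ∏ B, coeff (a B) (truncExp m (restrictBlock blk B (v j))) := fun j => by
    rw [← coeff_prod_truncExp_eq_prod (v j) (hv j).2 k hG a ha, ← hks]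
    exact logCoeff_eq_coeff_prod_truncExp (v j) (hv j).2 k hG hkA (hv j).1 hk0 m hkm
  unfold logDiff
  rw [Finset.sum_congr rfl (fun j _ => hu' j), Finset.sum_congr rfl (fun j _ => hv' j), ← Finset.mul_sum, ← Finset.mul_sum, ← mul_sub]

/-- The sign functional kills the column of the zero tuple. [folklore] -/
theorem signFun_expCol_zero (blk : Expo → Fin b) (u v : Fin m → MvPolynomial (Fin 2) ℂ) (hu0 : ∀ j, coeff 0 (u j) = 0)
    (hv0 : ∀ j, coeff 0 (v j) = 0) : signFun m (expCol blk u v (fun _ => 0)) = 0 := by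
  rw [signFun_apply]
  have h : ∀ i, expCol blk u v (fun _ => 0) i = 1 := by
    intro i
    show (∏ B, coeff (0 : Expo) (truncExp m (restrictBlock blk B (Fin.append u v i)))) = 1
    refine Finset.prod_eq_one fun B _ => coeff_zero_truncExp m (coeff_zero_restrictBlock blk B ?_)
    refine Fin.addCases (fun j => ?_) (fun j => ?_) i
    · rw [Fin.append_left]; exact hu0 j
    · rw [Fin.append_right]; exact hv0 j
  simp [h]

/-! ## Tie-free perturbation of a weight with respect to a finite set of points -/

/-- A weight can be perturbed so as to stay strictly below `l` on every point that was strictly below `l`, and to become injective on a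
given finite set of points. [folklore] -/
theorem exists_tieFree_weight (ξ : Fin 2 → ℝ) (P : Finset Expo) (l : Expo) :
    ∃ ξ' : Fin 2 → ℝ, (∀ p ∈ P, wt ξ p < wt ξ l → wt ξ' p < wt ξ' l) ∧ ∀ p ∈ P, ∀ q ∈ P, p ≠ q → wt ξ' p ≠ wt ξ' q := by
  classical
  obtain ⟨η, hη⟩ := exists_wt_injective
  set C : Finset (Expo × Expo) := ((insert l P) ×ˢ (insert l P)).filter (fun pq => wt ξ pq.1 < wt ξ pq.2) with hC
  obtain ⟨ε, hε, hεC⟩ := exists_eps_of_finset C (fun c => wt ξ c.1 - wt ξ c.2) (fun c => wt η c.1 - wt η c.2)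
    (fun c hc => by have := (Finset.mem_filter.1 hc).2; linarith)
  refine ⟨ξ + ε • η, fun p hp hlt => ?_, fun p hp q hq hne heq => ?_⟩
  · have h := hεC ε hε le_rfl (p, l) (Finset.mem_filter.2 ⟨Finset.mem_product.2 ⟨Finset.mem_insert_of_mem hp, Finset.mem_insert_self l P⟩, hlt⟩)
    simp only at h
    rw [wt_add_smul, wt_add_smul]
    linarith
  · rcases lt_trichotomy (wt ξ p) (wt ξ q) with h | h | h
    · have h2 := hεC ε hε le_rfl (p, q) (Finset.mem_filter.2 ⟨Finset.mem_product.2 ⟨Finset.mem_insert_of_mem hp, Finset.mem_insert_of_mem hq⟩, h⟩)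
      simp only at h2
      rw [wt_add_smul, wt_add_smul] at heq
      linarith
    · rw [wt_add_smul, wt_add_smul, h] at heq
      have : ε * (wt η p - wt η q) = 0 := by linarith
      rcases mul_eq_zero.1 this with h3 | h3
      · exact absurd h3 hε.ne'
      · exact hne (hη p q (by linarith))
    · have h2 := hεC ε hε le_rfl (q, p) (Finset.mem_filter.2 ⟨Finset.mem_product.2 ⟨Finset.mem_insert_of_mem hq, Finset.mem_insert_of_mem hp⟩, h⟩)
      simp only at h2
      rw [wt_add_smul, wt_add_smul] at heq
      linarith

/-! ## The bridge and the corollary -/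

/-- **K10 SHALLOW BRIDGE — `shallowVisible_holds : ShallowVisible`** (val-idea-37 g2's L2♭, text in `…ExpBlockTensor` rev 2). [folklore] -/
theorem shallowVisible_holds : ShallowVisible := by
  intro m b u v A blk hu hv hG ξ l hξ hl
  classical
  have hu0 : ∀ j, coeff 0 (u j) = 0 := fun j => (hu j).1
  have hv0 : ∀ j, coeff 0 (v j) = 0 := fun j => (hv j).1
  -- the visible point is the point of a non-zero shallow multiset
  have hlD : logDiff u v l ≠ 0 := hl.1
  have hlT : l ∈ (tailDiff u v).support := Finset.mem_coe.1 ((stub_logLinearisation m u v hu0 hv0 ξ hξ l).2 hl).1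
  obtain ⟨k, hkA, hkm, hks⟩ := exists_multiset_of_mem_support_tailDiff u v A (fun j => (hu j).2) (fun j => (hv j).2) l hlT
  have hk0 : k ≠ 0 := by
    rintro rfl
    rw [Multiset.sum_zero] at hks
    rw [← hks, logDiff_zero] at hlD
    exact hlD rfl
  -- its block tuple
  set E := shallowConfig A blk m with hE
  set a₀ : Fin b → Expo := fun B => (k.filter (fun e => blk e = B)).sum with ha₀
  have ha₀E : a₀ ∈ E := blockTuple_mem_shallowConfig A blk m k hkA hkm
  have ha₀s : ∑ B, a₀ B = l := by rw [← hks, sum_eq_sum_filter_sum blk k]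
  -- the shallow L1 at every tuple of `E`: `logDiff (Σ a) = c_a · φ (x a)` with `c_a ≠ 0`, or `a = 0`
  have hL1 : ∀ a ∈ E, logDiff u v (∑ B, a B) = 0 → signFun m (expCol blk u v a) = 0 := by
    intro a ha hD
    obtain ⟨k', hk'A, hk'm, hk'B, hk's⟩ := exists_multiset_of_mem_shallowConfig A blk m ha
    by_cases hk'0 : k' = 0
    · have : a = fun _ => 0 := by
        funext B; rw [← hk'B B, hk'0]; simp
      rw [this]
      exact signFun_expCol_zero blk u v hu0 hv0
    · have h := logDiff_eq_signFun_expCol u v hu hv k' (gradedAt_of_shallowGraded hG hk'A hk'm) hk'A hk'0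
        (fun B => (Multiset.card_le_card (Multiset.filter_le _ _)).trans hk'm) a hk'B
      rw [hD] at h
      have hc : (-1 : ℂ) ^ (Multiset.card k' + 1) * (Nat.factorial (Multiset.card k' - 1) : ℂ) ≠ 0 :=
        mul_ne_zero (pow_ne_zero _ (by norm_num)) (by exact_mod_cast (Nat.factorial_pos _).ne')
      rcases mul_eq_zero.1 h.symm with h1 | h1
      · exact absurd h1 hc
      · exact h1
  have hφl : signFun m (expCol blk u v a₀) ≠ 0 := by
    intro h0
    have h := logDiff_eq_signFun_expCol u v hu hv k (gradedAt_of_shallowGraded hG hkA hkm) hkA hk0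
      (fun B => (Multiset.card_le_card (Multiset.filter_le _ _)).trans hkm) a₀ (fun B => rfl)
    rw [ha₀s, h0, mul_zero] at h
    exact hlD h
  -- a tie-free perturbation of `ξ` on the points of `E`
  obtain ⟨ξ', hbelow, hinj⟩ := exists_tieFree_weight ξ (E.image fun a => ∑ B, a B) l
  refine ⟨a₀, ⟨ξ', ?_, ?_⟩, ha₀s⟩
  · -- injectivity of the height on `E`
    intro a ha a' ha' heq
    by_contra hne
    have hpt : (∑ B, a B) ≠ ∑ B, a' B := fun h => hne (eq_of_sum_eq_of_shallowGraded hG ha ha' h)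
    have h := hinj _ (Finset.mem_image_of_mem _ ha) _ (Finset.mem_image_of_mem _ ha') hpt
    exact h heq
  · -- the greedy certificate
    refine ⟨ha₀E, fun hspan => hφl ?_⟩
    -- `φ` vanishes on the span of the columns of the strictly higher tuples
    have hker : ∀ y ∈ Submodule.span ℂ (expCol blk u v '' {a' : Fin b → Expo | a' ∈ E ∧
        QuasiPoly.lin (fun a : Fin b → Expo => ((((∑ B, a B) (0 : Fin 2)) : ℕ) : ℝ))
          (fun a : Fin b → Expo => ((((∑ B, a B) (1 : Fin 2)) : ℕ) : ℝ)) ξ' a₀ <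
        QuasiPoly.lin (fun a : Fin b → Expo => ((((∑ B, a B) (0 : Fin 2)) : ℕ) : ℝ))
          (fun a : Fin b → Expo => ((((∑ B, a B) (1 : Fin 2)) : ℕ) : ℝ)) ξ' a'}), signFun m y = 0 := by
      intro y hy
      refine Submodule.span_induction (fun y hy => ?_) (by simp) (fun y z _ _ hy hz => by rw [map_add, hy, hz, add_zero])
        (fun c y _ hy => by rw [map_smul, hy, smul_zero]) hy
      obtain ⟨a', ⟨ha'E, hlt⟩, rfl⟩ := hy
      apply hL1 a' ha'E
      -- the point of `a'` is strictly `ξ'`-above `l`, hence not strictly `ξ`-below `l`, hence not in the log-support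
      have hlt' : wt ξ' l < wt ξ' (∑ B, a' B) := by
        have h : wt ξ' (∑ B, a₀ B) < wt ξ' (∑ B, a' B) := hlt
        rwa [ha₀s] at h
      by_contra hD
      have hne : (∑ B, a' B) ≠ l := by
        intro h
        have : a' = a₀ := eq_of_sum_eq_of_shallowGraded hG ha'E ha₀E (h.trans ha₀s.symm)
        rw [this, ha₀s] at hlt'
        exact lt_irrefl _ hlt'
      have hbl : wt ξ (∑ B, a' B) < wt ξ l := hl.2 _ hD hne
      have := hbelow _ (Finset.mem_image_of_mem _ ha'E) hbl
      linarith
    exact hker _ hspan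

/-- ★★ **K10 SHALLOW COROLLARY OF RECORD (unconditional): `blockShallowQuasiPoly_holds : BlockShallowQuasiPoly`** — on a SHALLOW-graded alphabet
with `b` blocks and block frames of size `≤ s`, every cell family has at most `(s+2)·((m+1)·8(2m+2)³)^⌈log₂ b⌉` points.  HONEST LABEL: proper positive
sub-case; 5906 / 5905 OPEN; VP ≠ VNP NOT proved. [folklore] -/
theorem blockShallowQuasiPoly_holds : BlockShallowQuasiPoly := by
  intro m b s u v A blk hu hv hG hs R S hS
  classical
  have hQ := shallowQ_holds m b s u v A blk hu hv hG hs
  set T := QuasiPoly.cshadow (shallowConfig A blk m) (expCol blk u v)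
    (fun a => ((((∑ B, a B) (0 : Fin 2)) : ℕ) : ℝ)) (fun a => ((((∑ B, a B) (1 : Fin 2)) : ℕ) : ℝ)) with hT
  -- choose for every point of the cell family its shadow tuple
  have hch : ∀ l ∈ S, ∃ a ∈ T, ∑ B, a B = l := by
    intro l hl
    obtain ⟨ξ, hξ, htop, -⟩ := hS l hl
    exact shallowVisible_holds m b u v A blk hu hv hG ξ l hξ htop
  choose! f hfT hfs using hch
  have hinj : Set.InjOn f (S : Set Expo) := by
    intro l hl l' hl' h
    have := congrArg (fun a : Fin b → Expo => ∑ B, a B) h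
    simp only [hfs l hl, hfs l' hl'] at this
    exact this
  have hmaps : Set.MapsTo f (S : Set Expo) T := fun l hl => hfT l hl
  calc S.card = (S : Set Expo).ncard := (Set.ncard_coe_finset S).symm
    _ ≤ T.ncard := Set.ncard_le_ncard_of_injOn f hmaps hinj (QuasiPoly.cshadow_finite _ _ _ _)
    _ ≤ _ := hQ

end Summit.ValiantsHypothesis.ValiantsHypothesis.Theorems.NewtonUnitEquations.TwoProducts.ExpBlock

end
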